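import Mathlib
import HarnessLib
import HarnessLib.Audit
import Summits.MatrixMultiplication.Statement
import Literature.Computability.AlgebraicComplexity.AsymptoticSpectrum
import HarnessLib.Audit.Status.Attr

/-!
Route: RootDecomp1

# Route RootDecomp1 — omega=2 split as Strassen's n^(4/3) asymptotic-rank law AND its declared
residual

WORKSHOP RECORD. Root decomposition cell decomp-mm (D-0178; doctrine D-0170/0171/0172), summit S =
`_root_.MatrixMultiplication` (ω(ℂ) = 2,
`MatrixMultiplication_iff`); LADDER-MatrixMultiplication rung 0 — NOTHING IN THIS ROUTE PROVES ω =
2. This is the writer's Theses file of record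
for node N6 «FourThirdsCarving» (lens decomp-mm-lens-6, barrier-complement carving; NODE
2026-08-30T01:34:09Z; lens file
HOME/decomp-mm-lens-6/FourThirdsCarving.lean sha256
ea2d2acfbcf1bed40056ebd76035d193ae94063a91f13299fca48be1a67e1922, lean check rc 0 / 0 sorry;
card HOME/decomp-mm-lens-6/NODE.md sha256
4382ed3b90b92dbcac5e23d5b34fd128c8273d96166bfeb0a674419a5d8f787d), CLEARED by the critic
decomp-mm-crit-1 2026-08-30T01:41:25Z (HOME/STATUS.md; CRITIC-LEDGER.md row 2; critic probe
HOME/critic/L6_FourThirdsCarving_v1_probe.lean @f28eba4022175a1a — verdict: «EXACT 2-piece AND S ⟺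
FourThirdsLaw ∧ FourThirdsResidual (summit_iff_pieces, modulo the in-file hypothesis-def
StrassenTwoThirds = tree THEOREM Strassen1988_asymptoticRank_le_rpow_fin, signature match verified
at AsymptoticRankLeTwoThirdsOmega.lean:287), trivial seam closes = h₂ h₁ (declared), no EQUIV layer,
ROOT = _root_.MatrixMultiplication ✓; typing clean; TAGS FourThirdsLaw WEAKER·NEC·ATTACKABLE-NOW via
the typed rung FourThirdsLawAt 3 + INSTRUMENTABLE; FourThirdsResidual
DECLARED-RESIDUAL(AR(4/3))·NEC(vacuous)·formally WEAKER·IDEA-NEEDED; SCORE baseline (AR(4/3) → S),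
declared next stop = the dial ALCubeLawAtTwo; w1–w3 non-blocking»); instrument data
HOME/census/COSTUME-CENSUS-v1.md sha256 c29cac34…b683466e (row W9 «asymptotic-rank exponent dial θ»,
kit 0 core-h this generation ⇒ numerical data
NULL) and COSTUME-CENSUS-v1.json sha256 86692f50…8e37; the AND/OR tree of the cell is HOME/TREE.md
(HOME = run/shared/lean/pub/decomp-mm/); OR-sibling
nodes (N2 FarEdgeDescent, lens-born route-MatrixMultiplication-FarEdgeDescent; N1, N3 drafts) are
separate route files.
GEN-2 RECORD (writer decomp-mm-writer-1 g2, 2026-08-30T02:46:09Z; cone of `closes` UNCHANGED). (a)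
TRIBUNAL census-trib-mm-1 g0 2026-08-30T02:42:18Z
(run/shared/lean/pub/route-census/trib/TRIB-MM-DECOMP.md + .tsv +
slim-route-MatrixMultiplication-RootDecomp1.json): verdict SPLIT-WITH-RESIDUAL (slim provisional) —
S ⟺ FourThirdsLaw ∧ FourThirdsResidual with the residual LITERALLY (FourThirdsLaw → S)
(TribMM.rd1_residual_unfold := Iff.rfl), trivial seam, closes axioms {propext, Classical.choice,
Quot.sound} → ROOT; attacked conjunct AR(4/3) genuine WEAKER (pays ω ≤ 8/3), necessity = Strassen
1988 (tree theorem, olean unbuilt ⇒ kernel-owed); gen-1 split exact (TribMM.rd1_split_exact), glue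
stmt-24513 provable now (TribMM.rd1_glue), 24510 TRUE (W-orbit interpolation lemma owed), 24511 =
the rung, COMPUTE-INSTRUMENTABLE not attackable this week, 24512 IDEA-NEEDED; residual stmt-24351
CONFIRMED summit-strength in practice = the NEXT DECOMPOSITION TARGET; aside 24352 = stronger dial,
print-necessary mod AlmanLi2026.thm71. (b) N6′ «UniversalLawTransfer» (lens decomp-mm-lens-6 g2,
NODE 2026-08-30T02:37:47Z; HOME/decomp-mm-lens-6/UniversalLawTransfer.lean sha256
c37f9aeb7219776d7a3dc2cf10b226421de50e135978acd4811a244baa889c92, rc 0 / 0 sorry / 0 warn; card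
NODE-g2.md sha256 32c9dd61e26064bc5fa77f20789afd506d46eb8dd7baff89a560d4a4a54713e1; writer package
HOME/decomp-mm-lens-6/g2/ (route.json native OK, tribunal --full PROVISIONAL,
RouteMock-RootDecomp1-edit.lean rc 0)) proposed S ⟺ FourThirdsLaw ∧ TwoThirdsTransfer («∀ w ≥ 2,
AR(2w/3) → ω ≤ w»; ⟺ ω ≤ max(2, (3/2)σ_∞); ⟺ [Alman–Li Problem 7.1 ⟹ S], lens kernel
transfer_iff_problem71). Critic decomp-mm-crit-1 g2 2026-08-30T02:43:32Z (HOME/STATUS.md l.79;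
CRITIC-LEDGER.md row of that utc): CLEARED AS AN EXACT AND with CORRECTION C2 — the label
«residual-free» is NOT accepted: TwoThirdsTransfer = RESIDUAL(FourThirdsLaw) + uniform-transfer
surplus (inert) = DECLARED-RESIDUAL(AL 7.1) ⟺ (UniformImprovement → S); it implies
FourThirdsResidual and not conversely (world (ω, σ_∞) = (2.3, 1.5)); the surplus instances w > 2 are
unused by the seam (w := 2) and INERT (their ¬S-branch needs asymptotic-rank lower bounds beyond
flattening); SCORE on N6 this generation: NONE (residual axis negative vs baseline 24351, law axis
unchanged); critic preference = writer option (i′) MINIMAL. (c) WRITER DECISION = option (i′)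
MINIMAL (placement is the writer's domain; agrees with the critic's preference and with the tribunal
naming 24351 the next target): the cone stays FourThirdsLaw ∧ FourThirdsResidual; TwoThirdsTransfer,
AlmanLiTransfer and UniformImprovement (= AL Problem 7.1, the residual's printed antecedent and
lit-instrument) are filed as ASIDES (rank 9, never staffed, bc6) — vocabulary for the residual's
next cut; no new tribunal wake is owed for this route (crux set unchanged). (d) Instrument data of
record: HOME/census/COSTUME-CENSUS-v2.md sha256
dfd08c2690e6e2a1aa208fc2d2f0df8f2fd2f1af1f0d3778844b39ec8720793b / COSTUME-CENSUS-v2.json sha256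
6563fe2c1649074ac8059a40bfc49e6df0f64f5f0d411b3483ce88536d73422c (rows D6a/D6b = this node; I6 =
instrument β: kit j337618 CP-ALS on T⊠T (9×9×9) for generic T — NO usable border-rank reading
(swamps even at r = 25, 26; no evidence for bR ≤ 21 here or in print; CGLV's numerical 22 and the
trivial 25 remain the facts), data HOME/census/data/kron-border-rank-v2.json sha256
5e49ab3f1f5d5c51ded2c661c95f4b49e025943b1b10693bfbfeea1b300669b6; recommendation: CGLV-grade
structured ansatz / homotopy, 20–60 core-h, or the cube — critic w7).
It suffices to show X = FourThirdsLaw ∧ FourThirdsResidual: FourThirdsLaw = Strassen's n^{4/3} law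
«every d × d × d complex tensor has asymptotic
rank ≤ d^{4/3}» [tag WEAKER · leaf ATTACKABLE (rungs FourThirdsLawAt d, first open d = 3) +
INSTRUMENTABLE (test β)] and FourThirdsResidual =
(FourThirdsLaw → S) [tag DECLARED-RESIDUAL(FourThirdsLaw), formally WEAKER (vacuous under S) · leaf
IDEA-NEEDED]. The node is EXACT:
S ⟺ FourThirdsLaw ∧ FourThirdsResidual given Strassen's theorem R̃(T) ≤ d^{2ω/3} (tree
`Strassen1988_asymptoticRank_le_rpow_fin`, module
AsymptoticRankLeTwoThirdsOmega; lens `summit_iff_pieces`); no EQUIV layer is used. Residual =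
fallback label (declared: FourThirdsResidual).
Lean: `(∀ (d : ℕ) (T : Fin d → Fin d → Fin d → ℂ),
Literature.Computability.AlgebraicComplexity.asymptoticRank T ≤ (d : ℝ) ^ (4 / 3 : ℝ)) ∧ ((∀ (d : ℕ)
(T : Fin d → Fin d → Fin d → ℂ), Literature.Computability.AlgebraicComplexity.asymptoticRank T ≤ (d
: ℝ) ^ (4 / 3 : ℝ)) → _root_.MatrixMultiplication)`

## Assembly
Trivial seam (flagged `trivial_seam`): FourThirdsResidual is literally FourThirdsLaw → S, so `closes
h₁ h₂ := h₂ h₁`. Exactness: S ⟹ FourThirdsLaw by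
Strassen's R̃(T) ≤ d^{2ω/3} at ω = 2, S ⟹ FourThirdsResidual vacuously (lens `summit_iff_pieces`).
The deciding theorem `closes` (glue.lean) consumes
exactly the two cruxes; the rank-9 item ALCubeLawAtTwo is an aside (bc6; dial record), the Assembly
item below is the schema record of the same implication.

Rationale: WHY THIS LINE. Lens 6 read the summit's barrier catalogue (Literature/Barriers/MatrixMultiplication:
UniversalMethod/Galactic, Irreversibility, Rectangular,
UnstableTensor, TricoloredSumFree, NilpotentGroup/Sawin,
Quasirandom/Normalizer/PackingBoundSequences, YoungSubgroup, BoundedRankFrame, GradedPacking,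
Equivoluminous, InfimumNotMinimum, LinearRankMethod) for its COMMON HYPOTHESIS — «a certificate ω ≤
c through a CARRIER tensor/group» — and carved
the complement by construction: consequences of ω = 2 that quantify over ALL tensors and certify
nothing below the record. Strassen's theorem
R̃(T) ≤ d^{2ω/3} (Strassen1988; ChristandlHoeberechtsNieuwboerVranaZuiddam2025 §1, arXiv:2411.15789
p.3) makes the n^{4/3} law NECESSARY for
ω = 2 (kernel modulo the accepted tree theorem), while the only door back to ω is ⟨2,2,2⟩ ⊂ 4×4×4,
which returns ω ≤ 8/3 (lens kernel
`omega_le_eight_thirds_of_fourThirdsLaw`) — above the record 2.37295 (`LeGall2014_cw4_omega_le`), so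
the piece is strictly WEAKER and outside
every catalogued barrier class. Imported area: asymptotic spectra / tensor degeneration (Strassen
1988, Alman–Li 2026 arXiv:2605.21738 Cor 4.1 and
Thm 7.1, Kaski–Michałek arXiv:2404.06427). What prior routes do not do: none of the 80 Theses of the
summit and no registered item types the
4/3-law or any σ(d)-statement as a crux (writer vocabulary W1 / census W9 only); the negatives index
(12 refuted statements) has no asymptotic-rank
law over all tensors.

RANKED CRUXES. #2 FourThirdsLaw (crux) — piece A — Strassen's n^{4/3} law: every d × d × d complex
tensor T has asymptotic rank R̃(T) ≤ d^{4/3}. Tag WEAKER (S ⟹ A: tree theorem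
`Strassen1988_asymptoticRank_le_rpow_of_omega_eq_two` / `_fin`, census W9, lens
`fourThirdsLaw_of_summit` modulo the hypothesis-def `StrassenTwoThirds` because the module had no
hub olean at filing; A ⟹ S unknown: lens kernel `omega_le_eight_thirds_of_fourThirdsLaw` gives only
ω ≤ 8/3). Leaf ATTACKABLE via the rungs FourThirdsLawAt d (d = 0, 1 kernel; d = 2 print; d = 3 FIRST
OPEN: known 3 + 2^{ω/3} ≤ 4.7306 vs needed 3^{4/3} = 4.3267) + INSTRUMENTABLE (test β, MM-free:
border rank of Kronecker squares/cubes of 3×3×3 tensors, bR(T⊠T) ≤ 18 or bR(T^{⊠3}) ≤ 81 ⇒ rung 3 by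
lens `rung_three_of_kroneckerPow`; prior art and target of the instrument (critic w2): CGLV
arXiv:1909.04785 Thm* 2.13 [corpus p.6] bR(T^{⊠2}) ≤ 22 < 25 for ALL T ∈ (ℂ³)^{⊗3} (numerical proof;
Problem 2.14 asks for a symbolic one) ⇒ √22 = 4.690, so the gap 22 → 18 is the real target; the rung
lives on the border-rank-5 stratum (bR(T) ≤ 4 ⟹ R̃ ≤ 4 < 4.3267)). The rung FourThirdsLawAt 3 is
filed as a SPLIT CHILD of this crux right after birth (ledger `route edit --split`, two layers,
D-0019), not as a free item (bc6). [difficulty: open-problem] (why it might fail: false iff some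
tensor family has σ(T) > 4/3, which by Strassen's bound forces ω > 2 — it cannot fail without S
failing; the risk is hardness (rung d = 3: 4.7306 known vs 4.3267 needed; MM-host lines need ω <
2.0984 < 2.16805).) [Strassen1988, arXiv:2411.15789, arXiv:2605.21738, arXiv:2404.06427]
#3 FourThirdsResidual (crux) — piece B — the declared residual «if every complex tensor obeys the
n^{4/3} law then ω(ℂ) = 2» (spectrally: every point of the asymptotic spectrum with
matrix-multiplication weight > 2 exceeds d^{4/3} on some cube). Tag
DECLARED-RESIDUAL(FourThirdsLaw), formally WEAKER = vacuous under S (lens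
`fourThirdsResidual_of_summit`); leaf IDEA-NEEDED, no performable test this round (the weakest exact
complement; no linear complement in (ω, σ_∞) exists since S does not pin σ_∞). [deps: FourThirdsLaw]
[difficulty: open-problem] (why it might fail: false in a world with ω > 2 whose bad spectral points
are all tame (|p| ∈ (2, 8/3], u ≤ 4/3); nothing known excludes that world, and no degeneration-based
proof can exist (flattening room: the law pays only ω ≤ 8/3).) [Strassen1988,
ChristandlVranaZuiddam2023, arXiv:2411.15789]
#9 ALCubeLawAtTwo (support) — aside (DIAL record, NOT a binder of closes) — Alman–Li's cube law at
exponent 2: every d × d × d complex tensor, d ≥ 3, has R̃(T) ≤ B_d(2) = √(d^{8/3} + d^{4/3} − (d³ −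
d²)^{2/3}) (4.0223 at d = 3; kernel-necessary for S modulo tree `AlmanLi2026.thm71`, lens
`alCubeLawAtTwo_of_summit`; `fourThirdsLaw_of_alCubeLawAtTwo`: replacing piece A by this stronger
necessary law makes the residual weaker next round). [difficulty: open-problem] [arXiv:2605.21738]
#9 asides added in gen 2 (lens-6 N6′, writer option (i′); NOT binders of closes, never staffed):
TwoThirdsTransfer «∀ w ≥ 2: if every d × d × d complex tensor has R̃ ≤ d^{2w/3} then ω(ℂ) ≤ w»
[critic C2 tag: RESIDUAL(FourThirdsLaw) + uniform-transfer surplus (inert) = DECLARED-RESIDUAL(AL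
7.1) ⟺ (UniformImprovement → S); NEC outright (ω = 2 ≤ w); WEAKER (world (2.3, 2ω/3)); implies
FourThirdsResidual, not conversely; graded: TransferAt w is a theorem for w ≤ 3/2 and w ≥ 2.37295,
open on (3/2, 2.37295); lens kernel twoThirdsTransfer_of_summit / transfer_implies_residual /
transfer_iff_tight / transfer_iff_problem71 / twoThirdsTransfer_iff_window]; AlmanLiTransfer (dial
position AL, transfer piece; NEC outright; ALCubeLawAtTwo ∧ AlmanLiTransfer also decides S, lens
closes_AL; implied by TwoThirdsTransfer given the d = 2 rung); UniformImprovement = Alman–Li 2026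
Problem 7.1 in inf-free form «∃ δ > 0 ∀ d ∀ T, R̃(T) ≤ d^{2ω/3 − δ}» (NOT necessary for S, NOT a
piece: the residual's printed antecedent, banked as the lit-watch item — a proved δ makes
TwoThirdsTransfer ⟺ S and re-cuts the node one dial stop finer, lens summit_iff_of_law /
lawFrom_mono / transferOf_antitone).

TWO-LAYER PLAN. FourThirdsLaw ⇐ (∀ d, FourThirdsLawAt d) is definitional (lens
`fourThirdsLaw_iff_forall`). IMMEDIATE glued split (filed by the writer right after birth, critic w3
«rung FourThirdsLawAt 3 as support»): FourThirdsLaw ⇐ FourThirdsLawUpToTwo (support, PROVABLE-NOW: d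
= 0, 1 kernel in the lens file, d = 2 from border rank ≤ 2 on (ℂ²)^{⊗3}) → FourThirdsLawAtThree
(support-rung, ATTACKABLE-NOW, first open) → FourThirdsLawFromFour (crux, the open tail d ≥ 4) →
FourThirdsLaw, glue = case split on d (provable now). Later, by the DIAL:
FourThirdsLaw ⇐ ALCubeLawAtTwo ∧ FourThirdsLawAt 2 (lens `fourThirdsLaw_of_alCubeLawAtTwo`, kernel),
with the residual weakened to
(ALCubeLawAtTwo ∧ FourThirdsLawAt 2 → S) (lens `dialResidual_of_fourThirdsResidual`). Nothing filed
now.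

KILL CRITERIA. A tensor family with σ(T) > 4/3 refutes FourThirdsLaw AND the summit (route closes
`refuted:FourThirdsLaw`, and S is decided negatively); a
world-independent proof that FourThirdsResidual fails is impossible short of ¬S. A proof of
FourThirdsLaw contracts the route to its residual
(then re-thesise along the dial). The route is mooted by any proof of the registered STRONGER
hypothesis AsymptoticRankConjecture (#1).

NOT DECOMPOSED YET. The residual (IDEA-NEEDED: which structure of tame bad spectral points to
exclude); the rung ladder beyond d = 3; the choice between the 4/3
law and the Alman–Li dial as piece A (recorded as an aside, decided next round by the critic's score
«residual strictly weaker»). GEN 2: the tribunal (TRIB-MM-DECOMP 02:42:18Z) names the residual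
stmt-24351 the NEXT DECOMPOSITION TARGET; recorded candidate cuts, none taken this generation
because none redistributes difficulty (critic C2/SCORE NONE): (α) dial position AL — A_AL =
ALCubeLawAtTwo (24352, rung d = 3 asks 4.0223) ∧ residual(A_AL) (= AlmanLiTransfer-shaped, WEAKER
than residual(A); kernel fourThirdsLaw_of_alCubeLawAtTwo / dialResidual_of_transfer mod rung d = 2)
— critic w6; (β) the transfer reading TwoThirdsTransfer ⟺ (UniformImprovement → S) — stronger than
24351, surplus inert; (γ) wanted for gen 3: a universal law F between Str and AL with a cheaper d =
3 rung, or a NON-residual complement (a relative statement tying σ_∞ to ω provable from below ω —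
none linear exists, KM arXiv:2404.06427 §1).

CHEAPEST FALSIFIER. Rung d = 3 numerics (instrument test β, ≤ 10 core-h, requested from the census
seat in the NODE line): numerical border-rank upper estimates of
T⊠T and T^{⊠3} for random T ∈ ℂ^{3⊗3⊗3} and the Nurmiev normal-form families; bR(T⊠T) ≥ 19
generically would show the Kronecker-square
instrument cannot prove the rung (the rung itself survives). Not run here (kit_allowed = false for
writer and lens). GEN 2 RESULT (census decomp-mm-census-1 g2, COSTUME-CENSUS-v2 row I6, kit j337618
CP-ALS 32 cores × 66 s + j337660/j337687 LM timeboxed): plain CP-ALS gives NO border-rank reading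
for T⊠T (best relative residuals 0.0486 (r=18) … 0.0080 (21), 0.0025 (22), and still 0.0033/0.0024
at r = 25/26 where exact decompositions exist = swamp); no evidence for bR(T⊠T) ≤ 21 anywhere; the
falsifier is NOT decided either way; next instrument = CGLV-grade structured ansatz / homotopy from
the border-rank-5 normal form (20–60 core-h) or the cube T^⊠3 ≤ 81 (critic w7; census gen 3).

NUMBERS. ω(ℂ) ≤ 2.37295 kernel (`LeGall2014_cw4_omega_le`), < 2.371339 print (ADVXXZ 2025);
FourThirdsLaw ⟹ only ω ≤ 8/3 (lens kernel); rung d = 3: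
needed 3^{4/3} = 4.3267 < 4.33 (lens `three_rpow_four_thirds_lt`), known 3 + 2^{ω/3} ≤ 4.7306
(Alman–Li Cor 4.1), CGLV Thm* 2.13: bR(T^{⊠2}) ≤ 22 for all 3×3×3 T (√22 = 4.690; instrument target
18), dial value B₃(2) = 4.0223;
MM-host attack needs ω < 2.0984 < 2.16805 = ω_u(CW_q) (UniversalMethodBarrier).

DEFINITION REQUESTS. None (all pieces are over `asymptoticRank`; the necessity theorems live in the
accepted modules AsymptoticRankLeTwoThirdsOmega /
AlmanLi2026GeneralTensorBound, whose hub oleans were unbuilt at filing — not needed by the route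
file).

Novelty: Searches (2026-08-30, lens-6 + writer): rg over the 80 Theses/*.lean of the summit for
"asymptoticRank T ≤|4 / 3|FourThirds|sigma" (0 crux; writer vocabulary W1 in HOME/TREE.md; census
row W9); `ledger negatives --problem MatrixMultiplication` (12, none an asymptotic-rank law); lens
queries recorded in FourThirdsCarving.lean §D ([corpus:paper:arxiv-2411.15789 p.3 L21] CHNVZ: "if ω
= 2 then every tensor has R̃ ≤ n^{4/3}"; [galaxy:pdf:8451742512093230840] CGLVW Kronecker squares);
no print or tree theorem of shape FourThirdsLaw → S.
Nearest prior art found: arXiv:2411.15789 §1 (the law as a consequence of ω = 2, no converse);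
arXiv:2605.21738 Cor 4.1 / Thm 7.1 (the best rung bounds); registered STRONGER hypothesis #1
AsymptoticRankConjecture (θ = 1 end of the dial, COSTUME as a piece).
Delta: the first MM node whose attack piece quantifies over ALL cubic tensors off the
matrix-multiplication ray, with the kernel 8/3-weakness certificate, the numerically placed first
open rung d = 3 and an MM-free instrument, and the Alman–Li-at-2 dial recorded for the next round.
Claimed grade: new-combination  [refs: 2411.15789, 2605.21738, paper:arxiv-2411.15789]

Barriers (technique_class: asymptotic-spectrum, barrier-complement, asymptotic-rank): - technique_class: asymptotic-spectrum, barrier-complement, asymptotic-rank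
- Literature.Barriers.MatrixMultiplication.UniversalMethodBarrier: outside — FourThirdsLaw certifies
only ω ≤ 8/3 > 2.16805 and names no carrier tensor; the MM-host attack line on rung 3 (needs ω <
2.0984) would sit inside, which is why the bet is the MM-free Kronecker-power instrument.
- Literature.Barriers.MatrixMultiplication.IrreversibilityBarrier: outside — no fixed irreversible
intermediate tensor is used; the law is a universal upper bound on R̃, not a route to ω through a
carrier.
- Literature.Barriers.MatrixMultiplication.RectangularBarrier: n/a — no rectangular exponent occurs.
- Literature.Barriers.MatrixMultiplication.InfimumNotMinimumBarrier: outside — R̃(T) ≤ d^{4/3} is an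
infimum statement per tensor; no fixed-format rank certificate of ω = 2 is asserted.
- Literature.Barriers.MatrixMultiplication.LinearRankMethodBarrier: n/a — no rank lower bound is
claimed (the residual is IDEA-NEEDED precisely because lower-bound methods for R̃ beyond d do not
exist).
- Negatives index: 12 refuted statements (HyperoctahedralThreshold, TightWindows,
PrimeValConjecture, ModuleRankGrowth, HexagonClearance, ConeDesignThesis, RectangularThmB,
SeparableDesignsMultiplicative, SubgroupTriples, LevelTwoBeatsCubes, ExactLineDesign,
ExactFrameDesign) — all tensor-design / STPP / group statements; none is an asymptotic-rank law over
all tensors, nothing to steer around.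

History (route lifecycle, newest last):
- 2026-08-30T02:10:52Z · rev 4: informal re-worded for FourThirdsLawAtThree (planner-decomp-mm-writer-1-g0-0)

sub-problem: MatrixMultiplication · status: draft · opened planner-decomp-mm-writer-1-g0-0 2026-08-30T01:46:33Z · rev 5 · ledger route-MatrixMultiplication-RootDecomp1
GENERATED by the gate from the ledger (D-0016/17). Provers cite these decls: `theorem foo : Summit.MatrixMultiplication.MatrixMultiplication.Theses.RootDecomp1.<Decl> := …` in Summits/MatrixMultiplication/MatrixMultiplication/Theorems/<Name>.lean.
-/

namespace Summit.MatrixMultiplication.MatrixMultiplication.Theses.RootDecomp1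

open scoped BigOperators Topology Manifold Classical MeasureTheory ProbabilityTheory Matrix InnerProductSpace ComplexConjugate ContinuousMap
open Filter Set Function TopologicalSpace MeasureTheory

attribute [summit_statement] _root_.MatrixMultiplication

/-- item stmt-MatrixMultiplication-24350 · crux · rank 2 · SPLIT (gen 1) into FourThirdsLawUpToTwo, FourThirdsLawAtThree, FourThirdsLawFromFour + glue FourThirdsLawGlue · direct attempts still welcome (low priority) · by planner
why it might fail: false iff some tensor family has σ(T) > 4/3, which by Strassen's bound forces ω > 2 — it cannot fail without S failing; the risk is hardness (rung d = 3: 4.7306 known vs 4.3267 needed; MM-host lines need ω < 2.0984 < 2.16805).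
sources: Strassen1988, arXiv:2411.15789, arXiv:2605.21738, arXiv:2404.06427
[crux] piece A — Strassen's n^{4/3} law: every d × d × d complex tensor T has asymptotic rank R̃(T)
≤ d^{4/3}. Tag WEAKER (S ⟹ A: tree theorem `Strassen1988_asymptoticRank_le_rpow_of_omega_eq_two` /
`_fin`, census W9, lens `fourThirdsLaw_of_summit` modulo the hypothesis-def `StrassenTwoThirds`
because the module had no hub olean at filing; A ⟹ S unknown: lens kernel
`omega_le_eight_thirds_of_fourThirdsLaw` gives only ω ≤ 8/3). Leaf ATTACKABLE via the rungs
FourThirdsLawAt d (d = 0, 1 kernel; d = 2 print; d = 3 FIRST OPEN: known 3 + 2^{ω/3} ≤ 4.7306 vs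
needed 3^{4/3} = 4.3267) + INSTRUMENTABLE (test β, MM-free: border rank of Kronecker squares/cubes
of 3×3×3 tensors, bR(T⊠T) ≤ 18 or bR(T^{⊠3}) ≤ 81 ⇒ rung 3 by lens `rung_three_of_kroneckerPow`;
prior art and target of the instrument (critic w2): CGLV arXiv:1909.04785 Thm* 2.13 [corpus p.6]
bR(T^{⊠2}) ≤ 22 < 25 for ALL T ∈ (ℂ³)^{⊗3} (numerical proof; Problem 2.14 asks for a symbolic one) ⇒
√22 = 4.690, so the gap 22 → 18 is the real target; the rung lives on the border-rank-5 stratum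
(bR(T) ≤ 4 ⟹ R̃ ≤ 4 < 4.3267)). The rung FourThirdsLawAt 3 is filed as a SPLIT CHILD of this crux
right after birth (ledger `route edit --split`, two la -/
@[route_item "route-MatrixMultiplication-RootDecomp1", crux]
def FourThirdsLaw : Prop :=
  ∀ (d : ℕ) (T : Fin d → Fin d → Fin d → ℂ), Literature.Computability.AlgebraicComplexity.asymptoticRank T ≤ (d : ℝ) ^ (4 / 3 : ℝ)

-- parent: FourThirdsLaw · child (gen 1)
/--     item stmt-MatrixMultiplication-24512 · crux · rank 203 · open
    parent: FourThirdsLaw · by planner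
    why it might fail: false iff some d ≥ 4 tensor family has σ(T) > 4/3, which forces ω > 2 by Strassen's bound — cannot fail without the summit failing; the risk is hardness (no R̃ upper-bound technique uniform in d beyond laser/Alman–Li, whose exponent at d is (4/3)(ω/2) > 4/3).
    sources: Strassen1988, arXiv:2411.15789, arXiv:2605.21738
split child 3 of FourThirdsLaw (crux · OPEN TAIL · leaf IDEA-NEEDED/INSTRUMENTABLE per rung): the
n^{4/3} law at every format d ≥ 4 (WEAKER: necessary for ω = 2 by Strassen's R̃ ≤ d^{2ω/3}; through
⟨2,2,2⟩ ⊂ 4×4×4 it pays only ω ≤ 8/3). Known per d: Alman–Li Thm 7.1 R̃ ≤ B_d(ω) (exponent ↑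
4/3·(ω/2) > 4/3); the dial ALCubeLawAtTwo (aside stmt-24352) is the stronger necessary law B_d(2) ≤
d^{4/3} for d ≥ 3. -/
@[route_item "route-MatrixMultiplication-RootDecomp1"]
def FourThirdsLawFromFour : Prop :=
  ∀ d : ℕ, 4 ≤ d → ∀ T : Fin d → Fin d → Fin d → ℂ, Literature.Computability.AlgebraicComplexity.asymptoticRank T ≤ (d : ℝ) ^ (4 / 3 : ℝ)

-- parent: FourThirdsLaw · child (gen 1)
/--     item stmt-MatrixMultiplication-24510 · support · rank 201 · closed · proved by Summit.MatrixMultiplication.MatrixMultiplication.Theorems.FourThirdsLawUpToTwoProof.FourThirdsLawUpToTwo_holds (prover)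
    parent: FourThirdsLaw · by planner
    sources: arXiv:2411.15789, Strassen1988
split child 1 of FourThirdsLaw (support · KNOWN RANGE · leaf PROVABLE-NOW/M): the n^{4/3} law at the
formats d ≤ 2. d = 0, 1 are kernel in the lens file (fourThirdsLawAt_zero/_one: R̃ ≤ d³ ≤ d^{4/3});
d = 2 is print (CHNVZ arXiv:2411.15789 §1: σ(2) ≤ 1) and follows from border rank ≤ 2 on ℂ²⊗ℂ²⊗ℂ²
(σ₂(P¹×P¹×P¹) fills; then R̃ ≤ bR ≤ 2 < 2^{4/3}, tree AsymptoticRankBorderRank) — the classification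
step is the only work. -/
@[route_item "route-MatrixMultiplication-RootDecomp1"]
def FourThirdsLawUpToTwo : Prop :=
  ∀ d : ℕ, d ≤ 2 → ∀ T : Fin d → Fin d → Fin d → ℂ, Literature.Computability.AlgebraicComplexity.asymptoticRank T ≤ (d : ℝ) ^ (4 / 3 : ℝ)

-- `FourThirdsLawUpToTwo` holds: proved by `Summit.MatrixMultiplication.MatrixMultiplication.Theorems.FourThirdsLawUpToTwoProof.FourThirdsLawUpToTwo_holds` (its module imports this route file, so no `_holds` link can be stated here).

-- parent: FourThirdsLaw · child (gen 1)
/--     item stmt-MatrixMultiplication-24511 · support · rank 202 · open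
    parent: FourThirdsLaw · by planner
    sources: arXiv:2605.21738, arXiv:1909.04785, arXiv:2404.06427
split child 2 of FourThirdsLaw (support-RUNG · FINITE — one semialgebraic statement about ℂ³⊗ℂ³⊗ℂ³,
decidable in principle · COMPUTE-INSTRUMENTABLE; critic w4 2026-08-30T01:49:29Z, calibration w5
02:10:41Z replaces the earlier 'ATTACKABLE-NOW' tag): every 3×3×3 complex tensor has R̃(T) ≤ 3^{4/3}
= 4.3267 — the smallest open instance of the n^{4/3} law, well-posed. State of the art: R̃ ≤ 3 +
2^{ω/3} ≤ 4.7306 (Alman–Li arXiv:2605.21738 Cor 4.1, tree AlmanLi2026.cor41_complex) and √22 = 4.690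
from CGLV arXiv:1909.04785 Thm* 2.13 (bR(T⊠T) ≤ 22 for ALL T, NUMERICAL only — their Problem 2.14
asks for a symbolic proof). Only the border-rank-5 stratum is at issue (bR(T) ≤ 4 ⟹ R̃ ≤ 4, lens v2
rung_three_of_algBorderRank_le_four; those orbits are trivial). A kernel certificate needs
border-rank-≤-18 decompositions of T⊠T UNIFORMLY over the border-rank-5 locus of 3×3×3 tensors
(positive-dimensional moduli + its degenerations) or a cube bound bR(T^⊠3) ≤ 81 (sufficiency kernel
in lens-6 v2 @4f456d03: rung_three_of_borderRank_square/_cube; thresholds 18 = ⌊3^{8/3}⌋, 81 =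
(3^{4/3})³) — a compute-plus-algebra project, not a week's proving: instrument = numerical
border-rank search on Kronecker squ -/
@[route_item "route-MatrixMultiplication-RootDecomp1"]
def FourThirdsLawAtThree : Prop :=
  ∀ T : Fin 3 → Fin 3 → Fin 3 → ℂ, Literature.Computability.AlgebraicComplexity.asymptoticRank T ≤ (3 : ℝ) ^ (4 / 3 : ℝ)

-- parent: FourThirdsLaw · glue (gen 1)
/--     item stmt-MatrixMultiplication-24513 · support · rank 204 · closed · proved by Summit.MatrixMultiplication.MatrixMultiplication.Theorems.FourThirdsLawUpToTwoProof.FourThirdsLawGlue_holds (prover)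
    parent: FourThirdsLaw · GLUE: children ⟹ parent · by planner
… -/
@[route_item "route-MatrixMultiplication-RootDecomp1"]
def FourThirdsLawGlue : Prop :=
  FourThirdsLawUpToTwo → FourThirdsLawAtThree → FourThirdsLawFromFour → FourThirdsLaw

-- `FourThirdsLawGlue` holds: proved by `Summit.MatrixMultiplication.MatrixMultiplication.Theorems.FourThirdsLawUpToTwoProof.FourThirdsLawGlue_holds` (its module imports this route file, so no `_holds` link can be stated here).

/-- item stmt-MatrixMultiplication-24351 · crux · rank 3 · open · by planner
why it might fail: false in a world with ω > 2 whose bad spectral points are all tame (|p| ∈ (2, 8/3], u ≤ 4/3); nothing known excludes that world, and no degeneration-based proof can exist (flattening room: the law pays only ω ≤ 8/3).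
sources: Strassen1988, ChristandlVranaZuiddam2023, arXiv:2411.15789
[crux] piece B — the declared residual «if every complex tensor obeys the n^{4/3} law then ω(ℂ) = 2»
(spectrally: every point of the asymptotic spectrum with matrix-multiplication weight > 2 exceeds
d^{4/3} on some cube). Tag DECLARED-RESIDUAL(FourThirdsLaw), formally WEAKER = vacuous under S (lens
`fourThirdsResidual_of_summit`); leaf IDEA-NEEDED, no performable test this round (the weakest exact
complement; no linear complement in (ω, σ_∞) exists since S does not pin σ_∞). [deps: FourThirdsLaw]
[difficulty: open-problem] -/
@[route_item "route-MatrixMultiplication-RootDecomp1", crux]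
def FourThirdsResidual : Prop :=
  (∀ (d : ℕ) (T : Fin d → Fin d → Fin d → ℂ), Literature.Computability.AlgebraicComplexity.asymptoticRank T ≤ (d : ℝ) ^ (4 / 3 : ℝ)) → _root_.MatrixMultiplication

/-- item stmt-MatrixMultiplication-24352 · aside · rank 9 · open · by planner
sources: arXiv:2605.21738
[support] aside (DIAL record, NOT a binder of closes) — Alman–Li's cube law at exponent 2: every d ×
d × d complex tensor, d ≥ 3, has R̃(T) ≤ B_d(2) = √(d^{8/3} + d^{4/3} − (d³ − d²)^{2/3}) (4.0223 at
d = 3; kernel-necessary for S modulo tree `AlmanLi2026.thm71`, lens `alCubeLawAtTwo_of_summit`;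
`fourThirdsLaw_of_alCubeLawAtTwo`: replacing piece A by this stronger necessary law makes the
residual weaker next round). [difficulty: open-problem] -/
@[route_item "route-MatrixMultiplication-RootDecomp1"]
def ALCubeLawAtTwo : Prop :=
  ∀ (d : ℕ), 3 ≤ d → ∀ T : Fin d → Fin d → Fin d → ℂ, Literature.Computability.AlgebraicComplexity.asymptoticRank T ≤ Real.sqrt ((d : ℝ) ^ (4 * 2 / 3 : ℝ) + (d : ℝ) ^ (2 * 2 / 3 : ℝ) - ((d : ℝ) ^ 3 - (d : ℝ) ^ 2) ^ (2 / 3 : ℝ))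

/-- item stmt-MatrixMultiplication-25636 · aside · rank 9 · open · by planner
sources: Strassen1988, KaskiMichalek2025, arXiv:2404.06427, AlmanLi2026, arXiv:2605.21738, ChristandlHoeberechtsNieuwboerVranaZuiddam2025
[aside] Two-thirds transfer (lens-6 gen 2, node N6′ UniversalLawTransfer; filed as ASIDE by writer
option (i′) — NOT a binder of closes, never staffed) — for every real w ≥ 2: if every d × d × d
complex tensor has asymptotic rank ≤ d^{2w/3} (Strassen's universality law computed with the
putative exponent w), then ω(ℂ) ≤ w. Equivalently ω ≤ max(2, (3/2)σ_∞); equivalently [Alman–Li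
Problem 7.1 ⟹ ω = 2] (kernel transfer_iff_problem71). Tag WEAKER · NEC (ω = 2 ≤ w, kernel) · implies
gen 0's residual FourThirdsLaw → S, not conversely · GRADED (TransferAt w proved for w ≤ 3/2 and w ≥
2.37295; this crux = the window [2, 2.37295)) · leaf IDEA-NEEDED. Critic C2 2026-08-30T02:43:32Z:
tag = RESIDUAL(FourThirdsLaw) + uniform-transfer surplus (inert) = DECLARED-RESIDUAL(AL 7.1) ⟺
(UniformImprovement → S) (lens kernel transfer_iff_problem71); implies FourThirdsResidual stmt-24351
(transfer_implies_residual), not conversely; the w > 2 instances are unused by any seam at w := 2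
and inert (¬S-branch needs R̃ lower bounds beyond flattening, KM arXiv:2404.06427 p.2). Why it might
fail (lens): false iff ω > 2 AND Strassen's exponent 2ω/3 improves uniformly (∃ δ>0, σ(d) ≤ 2ω/3 − δ
∀ d = Alman–Li 2026 P -/
@[route_item "route-MatrixMultiplication-RootDecomp1"]
def TwoThirdsTransfer : Prop :=
  ∀ w : ℝ, 2 ≤ w → (∀ (d : ℕ) (T : Fin d → Fin d → Fin d → ℂ), Literature.Computability.AlgebraicComplexity.asymptoticRank T ≤ (d : ℝ) ^ (2 * w / 3)) → Literature.Computability.AlgebraicComplexity.omega ℂ ≤ w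

/-- item stmt-MatrixMultiplication-25637 · aside · rank 9 · open · by planner
sources: AlmanLi2026, arXiv:2605.21738
[aside] Dial position AL, transfer piece: for every w ≥ 2, if every d × d × d tensor with d ≥ 3
obeys Alman–Li's bound computed with the putative exponent w then ω(ℂ) ≤ w. Necessary outright;
implied by TwoThirdsTransfer given the d = 2 rung (kernel almanLiTransfer_of_twoThirdsTransfer);
ALCubeLawAtTwo ∧ AlmanLiTransfer also decides S (kernel closes_AL). -/
@[route_item "route-MatrixMultiplication-RootDecomp1"]
def AlmanLiTransfer : Prop :=
  ∀ w : ℝ, 2 ≤ w → (∀ (d : ℕ), 3 ≤ d → ∀ T : Fin d → Fin d → Fin d → ℂ, Literature.Computability.AlgebraicComplexity.asymptoticRank T ≤ Real.sqrt ((d : ℝ) ^ (4 * w / 3) + (d : ℝ) ^ (2 * w / 3) - ((d : ℝ) ^ 3 - (d : ℝ) ^ 2) ^ (w / 3))) → Literature.Computability.AlgebraicComplexity.omega ℂ ≤ w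

/-- item stmt-MatrixMultiplication-25638 · aside · rank 9 · open · by planner
sources: AlmanLi2026, arXiv:2605.21738
[aside] Alman–Li 2026 Problem 7.1 (arXiv:2605.21738 p.19), inf-free form: there is δ > 0 with R̃(T)
≤ d^{2ω/3 − δ} for every d and every d × d × d tensor. NOT necessary for S and NOT a piece: it is
the antecedent of TwoThirdsTransfer's residual reading (TwoThirdsTransfer ⟺ (UniformImprovement →
S), kernel transfer_iff_problem71); banked as the named watch item. -/
@[route_item "route-MatrixMultiplication-RootDecomp1"]
def UniformImprovement : Prop :=
  ∃ δ : ℝ, 0 < δ ∧ ∀ (d : ℕ) (T : Fin d → Fin d → Fin d → ℂ), Literature.Computability.AlgebraicComplexity.asymptoticRank T ≤ (d : ℝ) ^ (2 * Literature.Computability.AlgebraicComplexity.omega ℂ / 3 - δ)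

/-- item stmt-MatrixMultiplication-24353 · assembly · rank 1 · open · by planner
sources: Strassen1988
[assembly] FourThirdsLaw → FourThirdsResidual → ω(ℂ) = 2. -/
@[route_item "route-MatrixMultiplication-RootDecomp1"]
def Assembly : Prop :=
  FourThirdsLaw → FourThirdsResidual → _root_.MatrixMultiplication

/-! D-0027 §2.1 — DECIDING THEOREM (planner-authored via `route open/edit --closes-file`; by planner-decomp-mm-writer-1-g0-0 2026-08-30T01:46:33Z):
its hypotheses are this route's items and its conclusion the sub-problem Statement (glue_lint), and it elaborates with this file. -/

@[closes "route-MatrixMultiplication-RootDecomp1"] theorem closes (h₁ : FourThirdsLaw) (h₂ : FourThirdsResidual) : _root_.MatrixMultiplication := h₂ h₁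

end Summit.MatrixMultiplication.MatrixMultiplication.Theses.RootDecomp1
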